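import Literature.NumberTheory.LFunctions.FeketePolyaKernelCertificates
import Literature.NumberTheory.LFunctions.NoRealZeroOddSmallModuliV
import Literature.Barriers.RiemannHypothesis.EpsteinZetaRealZerosPairGrouping403
import Literature.Barriers.RiemannHypothesis.EpsteinZetaRealZerosPairGrouping408
import Literature.Barriers.RiemannHypothesis.EpsteinZetaRealZerosPairGrouping427
import HarnessLib

/-!
# No real zero for the ODD real primitive characters of conductor `≤ 436`, in the kernel
# (`NoRealZeroOddUpTo 436`)

Topic `Literature/NumberTheory/LFunctions`; namespace `Literature.NumberTheory.LFunctions`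
(private helpers in `….OddSmallModuliVI`). THEOREMS only (no definition, no named fact, no `sorry`).

The odd kernel base `402` (`noRealZeroOddUpTo_402`, `NoRealZeroOddSmallModuliV.lean`) is pushed to `436`:
**`noRealZeroOddUpTo_436 : NoRealZeroOddUpTo 436`**. Per modulus `402 < q ≤ 436` (one bullet each,
in the order of `interval_cases`): moduli without a primitive quadratic character are dismissed
(`q ≡ 2 (mod 4)`, `16 ∣ q`, `p² ∣ q` — MV Thm 9.13: 8 + 2 + 3 moduli); an even
primitive quadratic character is excluded by the parity test inside `OddSmallModuliII.good_odd_of_*`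
(8 moduli); the odd character `χ_{−q}` is certified by the ORDER-TWO Fekete–Pólya criterion
along the induced character mod `q·w` (engine `FeketePolyaKernelCertificates.runOK` of the cell seat
sweep-4, kernel `decide`; 10 moduli, multipliers from an integer scan of this seat, 2026-08-27:
`435` → `w = 14`); and the 3 discriminant(s) `403`, `408`, `427` without such a certificate come from LOW'S GROUPING of
the Epstein zeta functions of the class group
(`Literature/Barriers/RiemannHypothesis/EpsteinZetaRealZerosPairGrouping*.lean`, this seat).

## References

* H. L. Montgomery, R. C. Vaughan, *Multiplicative Number Theory I*, CUP 2007, §9.3 Thm 9.13, §11.2.1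
  Exercises 7–8. [MontgomeryVaughan2007]
* M. E. Low, *Real zeros of the Dedekind zeta function of an imaginary quadratic field*, Acta Arith. 14
  (1968) 117–140. [Low1968]
* M. Watkins, *Real zeros of real odd Dirichlet L-functions*, Math. Comp. 73 (2004) 415–423.
  [Watkins2004RealZeros]
-/

namespace Literature.NumberTheory.LFunctions

namespace OddSmallModuliVI

open FeketePolyaKernel PrimitiveQuadratic OddSmallModuliII
open Literature.Barriers.RiemannHypothesis

/-- Conductor `≡ 2 (mod 4)`: no primitive character (private copy of the sweep-4 lemma).
[cite: MontgomeryVaughan2007, §9.3 Theorem 9.13] -/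
private theorem absurd_of_mod_four_two {q : ℕ} [NeZero q] (hq : q % 4 = 2)
    {χ : DirichletCharacter ℂ q} (hprim : χ.IsPrimitive) : False := by
  obtain ⟨m, rfl⟩ : ∃ m, q = 2 * m := ⟨q / 2, by omega⟩
  haveI : NeZero m := ⟨by omega⟩
  exact not_isPrimitive_two_mul (m := m) (Nat.odd_iff.mpr (by omega)) hprim

/-- Conductor divisible by `16`: no primitive quadratic character (private copy).
[cite: MontgomeryVaughan2007, §9.3 Theorem 9.13] -/
private theorem absurd_of_sixteen_dvd {q : ℕ} [NeZero q] (hq : q % 16 = 0) {χ : DirichletCharacter ℂ q}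
    (hprim : χ.IsPrimitive) (hquad : χ.IsQuadratic) : False := by
  obtain ⟨k, m, hm, rfl⟩ := Nat.exists_eq_two_pow_mul_odd (NeZero.ne q)
  have hm2 := Nat.odd_iff.mp hm
  haveI : NeZero m := ⟨by omega⟩
  have hk := le_three_of_level_two_pow_mul hm hprim hquad
  interval_cases k <;> norm_num at hq <;> omega

/-- Conductor with an odd square factor `p²`: no primitive quadratic character (private copy).
[cite: MontgomeryVaughan2007, §9.3 Theorem 9.13] -/
private theorem absurd_of_sq_dvd {q : ℕ} [NeZero q] {p : ℕ} (hp : p.Prime) (hp2 : p ≠ 2)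
    (hpq : p * p ∣ q) {χ : DirichletCharacter ℂ q} (hprim : χ.IsPrimitive) (hquad : χ.IsQuadratic) :
    False := by
  obtain ⟨k, m, hm, rfl⟩ := Nat.exists_eq_two_pow_mul_odd (NeZero.ne q)
  have hm2 := Nat.odd_iff.mp hm
  haveI : NeZero m := ⟨by omega⟩
  have hsq := squarefree_of_level_two_pow_mul hm hprim hquad
  have hp2' : Nat.Coprime p 2 := (Nat.coprime_primes hp Nat.prime_two).mpr hp2
  have hcop : Nat.Coprime (p * p) (2 ^ k) := Nat.Coprime.pow_right k (Nat.Coprime.mul_left hp2' hp2')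
  have hpm : p * p ∣ m := hcop.dvd_of_dvd_mul_left hpq
  exact hp.one_lt.ne' (Nat.isUnit_iff.mp (hsq p hpm))

/-- **No real zero in `(0, 1)` for every odd real primitive character of conductor `402 < q ≤ 436`**
(one kernel computation per modulus, in the order of `interval_cases`). [cite: MontgomeryVaughan2007, §11.2.1 Exercises 7 (g), 8]
[cite: Low1968, Theorem 5 (via MR 38#4425)] -/
theorem range_403_436 (q : ℕ) [NeZero q] (hlo : 402 < q) (hhi : q ≤ 436) :
    ∀ χ : DirichletCharacter ℂ q, χ.IsQuadratic → χ.IsPrimitive → χ.Odd →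
      ∀ σ : ℝ, 0 < σ → σ < 1 → χ.LFunction σ ≠ 0 := by
  interval_cases q
  · -- 403
    exact fun _ hquad hprim hodd _ hσ0 hσ1 ↦
      LFunction_ne_zero_of_odd_quadratic_403 hprim hquad hodd hσ0 hσ1
  · -- 404
    exact good_odd_of_four (by decide) (by decide) 1 (by decide) (by decide +kernel)
  · -- 405
    exact fun χ hquad hprim _ ↦
      (absurd_of_sq_dvd (p := 3) (by norm_num) (by decide) (by decide) hprim hquad).elim
  · -- 406
    exact fun χ hquad hprim _ ↦ (absurd_of_mod_four_two (by decide) hprim).elim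
  · -- 407
    exact good_odd_of_odd (by decide) (by decide) 1 (by decide) (by decide +kernel)
  · -- 408
    exact fun _ hquad hprim hodd _ hσ0 hσ1 ↦
      LFunction_ne_zero_of_odd_quadratic_408 hprim hquad hodd hσ0 hσ1
  · -- 409
    exact good_odd_of_odd (by decide) (by decide) 1 (by decide) (by decide +kernel)
  · -- 410
    exact fun χ hquad hprim _ ↦ (absurd_of_mod_four_two (by decide) hprim).elim
  · -- 411
    exact good_odd_of_odd (by decide) (by decide) 1 (by decide) (by decide +kernel)
  · -- 412
    exact good_odd_of_four (by decide) (by decide) 1 (by decide) (by decide +kernel)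
  · -- 413
    exact good_odd_of_odd (by decide) (by decide) 1 (by decide) (by decide +kernel)
  · -- 414
    exact fun χ hquad hprim _ ↦ (absurd_of_mod_four_two (by decide) hprim).elim
  · -- 415
    exact good_odd_of_odd (by decide) (by decide) 1 (by decide) (by decide +kernel)
  · -- 416
    exact fun χ hquad hprim _ ↦ (absurd_of_sixteen_dvd (by decide) hprim hquad).elim
  · -- 417
    exact good_odd_of_odd (by decide) (by decide) 1 (by decide) (by decide +kernel)
  · -- 418
    exact fun χ hquad hprim _ ↦ (absurd_of_mod_four_two (by decide) hprim).elim
  · -- 419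
    exact good_odd_of_odd (by decide) (by decide) 1 (by decide) (by decide +kernel)
  · -- 420
    exact good_odd_of_four (by decide) (by decide) 1 (by decide) (by decide +kernel)
  · -- 421
    exact good_odd_of_odd (by decide) (by decide) 1 (by decide) (by decide +kernel)
  · -- 422
    exact fun χ hquad hprim _ ↦ (absurd_of_mod_four_two (by decide) hprim).elim
  · -- 423
    exact fun χ hquad hprim _ ↦
      (absurd_of_sq_dvd (p := 3) (by norm_num) (by decide) (by decide) hprim hquad).elim
  · -- 424
    exact good_odd_of_eight (by decide) (by decide) 1 (by decide) (by decide +kernel) (by decide +kernel)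
  · -- 425
    exact fun χ hquad hprim _ ↦
      (absurd_of_sq_dvd (p := 5) (by norm_num) (by decide) (by decide) hprim hquad).elim
  · -- 426
    exact fun χ hquad hprim _ ↦ (absurd_of_mod_four_two (by decide) hprim).elim
  · -- 427
    exact fun _ hquad hprim hodd _ hσ0 hσ1 ↦
      LFunction_ne_zero_of_odd_quadratic_427 hprim hquad hodd hσ0 hσ1
  · -- 428
    exact good_odd_of_four (by decide) (by decide) 1 (by decide) (by decide +kernel)
  · -- 429
    exact good_odd_of_odd (by decide) (by decide) 1 (by decide) (by decide +kernel)
  · -- 430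
    exact fun χ hquad hprim _ ↦ (absurd_of_mod_four_two (by decide) hprim).elim
  · -- 431
    exact good_odd_of_odd (by decide) (by decide) 1 (by decide) (by decide +kernel)
  · -- 432
    exact fun χ hquad hprim _ ↦ (absurd_of_sixteen_dvd (by decide) hprim hquad).elim
  · -- 433
    exact good_odd_of_odd (by decide) (by decide) 1 (by decide) (by decide +kernel)
  · -- 434
    exact fun χ hquad hprim _ ↦ (absurd_of_mod_four_two (by decide) hprim).elim
  · -- 435
    exact good_odd_of_odd (by decide) (by decide) 14 (by decide) (by decide +kernel)
  · -- 436
    exact good_odd_of_four (by decide) (by decide) 1 (by decide) (by decide +kernel)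

end OddSmallModuliVI

open OddSmallModuliVI in
/-- **`NoRealZeroOddUpTo 436`, unconditionally**: no odd real primitive character of conductor `≤ 436`
has a real zero in `(0, 1)` (`q ≤ 402`: `noRealZeroOddUpTo_402`; `402 < q ≤ 436`: `range_403_436`).
[cite: Low1968, Theorem 5 (via MR 38#4425)] [cite: MontgomeryVaughan2007, §11.2.1 Exercises 7 (g), 8] -/
theorem noRealZeroOddUpTo_436 : NoRealZeroOddUpTo 436 := by
  intro q _ hq3 hq χ hquad hprim hodd σ hσ0 hσ1
  by_cases h : q ≤ 402
  · exact noRealZeroOddUpTo_402 q hq3 h χ hquad hprim hodd σ hσ0 hσ1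
  · exact range_403_436 q (by omega) hq χ hquad hprim hodd σ hσ0 hσ1

end Literature.NumberTheory.LFunctions
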